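import Literature.Analysis.FluidPDE.GrujicRuzmaikina2004HybridDirectionCriterion
import Literature.Analysis.FluidPDE.HolderDirectionVorticityLpCriterion
import Literature.Analysis.FluidPDE.TaoClassQuotientBalance
import HarnessLib

/-!
# Grujić–Ruzmaikina 2004, Theorem 4.1 — PROVED (discharge of the named fact
# `grujicRuzmaikina2004_hybrid_direction_criterion`)

Analysis/FluidPDE proof file (theorems only: no definition, no named fact, no `sorry`): the
discharge `grujicRuzmaikina2004_hybrid_direction_criterion_holds` of the named fact vendored in
`GrujicRuzmaikina2004HybridDirectionCriterion.lean` (Z. Grujić, A. Ruzmaikina, Indiana Univ.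
Math. J. **53** (2004) 1073–1080, **Theorem 4.1** p. 1076: for a solution with
`‖ω‖_q^{q/(q−1)} ∈ L¹(0,T)` and `|sin φ(ξ(x+y), ξ(x))| ≤ c|y|^{1/q}` on the high-vorticity set
`Ω_t(M)`, `q ≥ 2`, one has `lim_{t↑T} ‖ω(t)‖_q < ∞`).

## Proof (and where it deviates from print)

The printed proof (pp. 1077–1079) is an `L^{2p}`-level a priori estimate: the vorticity equation
is tested against `|ω|^{2p−2}ω` ((4.2)–(4.3)), the strain is split along `ω = ω⁽¹⁾ + ω⁽²⁾`
(low/high vorticity), the `ω⁽¹⁾`-terms are handled by Calderón–Zygmund, Constantin's a priori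
`L¹` bound on `ω` and Gagliardo–Nirenberg ((4.4)–(4.7)), and the `ω⁽²⁾ω⁽²⁾`-term by Constantin's
singular-integral representation of `α` with the geometric hypothesis (ii), a Riesz potential of
order `1/q` and hypothesis (i); Remark 4.3: "a rigorous proof is easily obtained by the standard
continuation argument".

Here the tree already provides the whole a priori step, at the `L²` (enstrophy) level, so the
discharge takes that shorter road (deviation from print, recorded): the exponent pair of
Theorem 4.1 — direction Hölder exponent `β = 1/q` in (ii), vorticity magnitude in
`L^{q/(q−1)}(0,T; L^q)` in (i) — is the point `r = q`, `r₂ = q/(q−1)` of the scaling line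
`2/r₂ + 3/r = 2 + β` of the PROVED tree criterion `holder_direction_vorticityLqLp_criterion_of_late`
(`HolderDirectionVorticityLpCriterion.lean`; Chae 2007, Thm. 1.2 (1.12) with a constant majorant,
joining Beirão da Veiga 2002 / 2019): indeed `2(q−1)/q + 3/q = 2 + 1/q`, i.e. in that theorem's
parameters `θ = 1 + β/2 − (3/2)(1/r) = 1 − 1/q = 1/r₂`, with `βr = 1 < 3` and
`1/r ≤ 1/2 < (2+β)/3`. The one-sided hypothesis (ii) ("for all `x ∈ Ω_t(M)`" and all `y`) implies
the two-sided form used by the tree (both `|ω(x,t)|, |ω(y,t)| > max(M,1)`), the sine being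
`|sin φ(a,b)| = ‖a × b‖ = √(1 − ⟪a,b⟫²)` for unit vectors (`norm_cross`, Lagrange's identity), and
the hypotheses on the late interval `[T/2, T)` suffice. That criterion yields continuation in the
Beale–Kato–Majda class past `T` (`HasSobolevExtensionPast`); the printed conclusion
`lim_{t↑T} ‖ω(t)‖_q < ∞` then follows from the uniform Sobolev bounds of the continuation on
`[0, T]`: the vorticity family has bounded Sobolev norms (`hasBoundedSobolevNormsOn_curl`), hence is
bounded pointwise by the Sobolev imbedding `H² ⊂ C_B`
(`HasBoundedSobolevNormsOn.exists_forall_norm_iteratedFDeriv_le`) and in `L²`, and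
`∫|ω|^q ≤ ‖ω‖_∞^{q−2} ∫|ω|²` for `q ≥ 2`.

No regularity claim about Navier–Stokes is made beyond the printed theorem.

## References

* Z. Grujić, A. Ruzmaikina, Indiana Univ. Math. J. 53 (2004) 1073–1080,
  doi:10.1512/iumj.2004.53.2415: Thm. 4.1 (p. 1076), proof (4.1)–(4.11) (pp. 1077–1079),
  Remarks 4.2–4.5 (held text read, PDF pp. 4–7). [GrujicRuzmaikina2004]
* D. Chae, Rev. Mat. Iberoam. 23 (2007) 371–384, Thm. 1.2, (1.12) (p. 375) — the scaling line
  (tree theorem `holder_direction_vorticityLqLp_criterion`). [Chae2007RMI]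
* H. Beirão da Veiga, L. C. Berselli, Differential Integral Equations 15 (2002) 345–356 — the
  end-point `q = 2` (tree theorem `holderHalf_direction_criterion`). [BeiraodaveigaBerselli2002]
* R. A. Adams, J. J. F. Fournier, *Sobolev Spaces*, 2nd ed. (2003), Thm. 4.12 Part I Case A —
  the imbedding `W^{2,2}(ℝ³) ⊂ C_B(ℝ³)`. [AdamsFournier2003]
-/

noncomputable section

open MeasureTheory Set Function Filter Metric Real InnerProductSpace
open _root_.Topology
open scoped ENNReal NNReal RealInnerProductSpace ContDiff

namespace Literature.Analysis.FluidPDE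

/-! ### The sine of the angle between unit vectors -/

/-- Lagrange's identity for unit vectors of `ℝ³`: `‖a × b‖ = √(1 − ⟪a, b⟫²)` — both sides are
`|sin ∠(a, b)|` (`norm_cross`: `‖a × b‖ = ‖a‖‖b‖ sin ∠(a,b)`, `⟪a,b⟫ = ‖a‖‖b‖ cos ∠(a,b)`, the angle
in `[0, π]`). This identifies the sign-blind coherence hypothesis of
`grujicRuzmaikina2004_hybrid_direction_criterion` ("`|sin φ(ξ(x+y), ξ(x))|`", p. 1076) with the
rendering `√(1 − ⟪ξ(x), ξ(y)⟫²)` of the tree's direction criteria. [cite: GrujicRuzmaikina2004, §3 p. 1076 (`|D| ≤ |sin φ|`)] -/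
theorem norm_cross_eq_sqrt_one_sub_inner_sq {a b : EuclideanSpace ℝ (Fin 3)} (ha : ‖a‖ = 1)
    (hb : ‖b‖ = 1) : ‖cross a b‖ = Real.sqrt (1 - ⟪a, b⟫ ^ 2) := by
  have hθ := norm_cross a b
  have hcos : Real.cos (InnerProductGeometry.angle a b) * (‖a‖ * ‖b‖) = ⟪a, b⟫ :=
    InnerProductGeometry.cos_angle_mul_norm_mul_norm a b
  rw [ha, hb, one_mul, one_mul] at hθ
  rw [ha, hb, mul_one, mul_one] at hcos
  have hsin : 0 ≤ Real.sin (InnerProductGeometry.angle a b) :=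
    Real.sin_nonneg_of_nonneg_of_le_pi (InnerProductGeometry.angle_nonneg a b)
      (InnerProductGeometry.angle_le_pi a b)
  rw [hθ, ← hcos, ← Real.sin_sq, Real.sqrt_sq hsin]

/-! ### `L^q` bounds of the vorticity in the Beale–Kato–Majda class -/

/-- In a family of smooth fields with all `L²` Sobolev seminorms bounded on a time set `S`, the
`L^q` norms of the vorticity, `2 ≤ q < ∞`, are bounded on `S`: `ω = curl u` is bounded pointwise
(Sobolev imbedding `H² ⊂ C_B` for the curl family) and in `L²`, and `∫|ω|^q ≤ ‖ω‖_∞^{q−2}∫|ω|²`.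
[cite: AdamsFournier2003, Thm. 4.12 Part I Case A (mp > n)] -/
theorem exists_eLpNorm_curl_le_of_hasBoundedSobolevNormsOn {S : Set ℝ}
    {u : ℝ → EuclideanSpace ℝ (Fin 3) → EuclideanSpace ℝ (Fin 3)}
    (hH : HasBoundedSobolevNormsOn S u) (hsm : ∀ t ∈ S, ContDiff ℝ ∞ (u t)) {q : ℝ}
    (hq : 2 ≤ q) :
    ∃ K : ℝ≥0∞, K < ⊤ ∧ ∀ t ∈ S, eLpNorm (curl (u t)) (ENNReal.ofReal q) volume ≤ K := by
  have hq0 : 0 < q := by linarith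
  have hcurl : HasBoundedSobolevNormsOn S fun t => curl (u t) := hasBoundedSobolevNormsOn_curl hH hsm
  have hsmc : ∀ t ∈ S, ContDiff ℝ ∞ (curl (u t)) := fun t ht =>
    contDiff_curl (n := (⊤ : ℕ∞)) (by simpa using hsm t ht)
  obtain ⟨B, hB0, hB⟩ := hcurl.exists_forall_norm_iteratedFDeriv_le hsmc 0
  obtain ⟨C₀, hC₀⟩ := hcurl 0
  -- the constant
  set K : ℝ≥0∞ := (ENNReal.ofReal B ^ (q - 2) * (C₀ : ℝ≥0∞)) ^ (1 / q) with hK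
  have hKtop : K < ⊤ := by
    refine ENNReal.rpow_lt_top_of_nonneg (by positivity) (ENNReal.mul_ne_top ?_ ENNReal.coe_ne_top)
    exact ENNReal.rpow_ne_top_of_nonneg (by linarith) ENNReal.ofReal_ne_top
  refine ⟨K, hKtop, fun t ht => ?_⟩
  have hqE0 : ENNReal.ofReal q ≠ 0 := (ENNReal.ofReal_pos.2 hq0).ne'
  rw [eLpNorm_eq_lintegral_rpow_enorm_toReal hqE0 ENNReal.ofReal_ne_top,
    ENNReal.toReal_ofReal hq0.le, hK]
  gcongr
  -- `∫ |ω|^q ≤ B^{q-2} ∫ |ω|²`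
  have hpt : ∀ x, ‖curl (u t) x‖ₑ ^ q ≤ ENNReal.ofReal B ^ (q - 2) * ‖curl (u t) x‖ₑ ^ 2 := by
    intro x
    have hle : ‖curl (u t) x‖ₑ ≤ ENNReal.ofReal B := by
      rw [← ofReal_norm]
      refine ENNReal.ofReal_le_ofReal ?_
      have h := hB t ht x
      rwa [norm_iteratedFDeriv_zero] at h
    have hsplit : ‖curl (u t) x‖ₑ ^ q = ‖curl (u t) x‖ₑ ^ (q - 2) * ‖curl (u t) x‖ₑ ^ (2 : ℝ) := by
      rw [← ENNReal.rpow_add_of_nonneg (q - 2) 2 (by linarith) (by norm_num)]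
      congr 1
      ring
    rw [hsplit, ENNReal.rpow_two]
    gcongr
  calc ∫⁻ x, ‖curl (u t) x‖ₑ ^ q
      ≤ ∫⁻ x, ENNReal.ofReal B ^ (q - 2) * ‖curl (u t) x‖ₑ ^ 2 := lintegral_mono hpt
    _ = ENNReal.ofReal B ^ (q - 2) * ∫⁻ x, ‖curl (u t) x‖ₑ ^ 2 := by
        rw [lintegral_const_mul' _ _
          (ENNReal.rpow_ne_top_of_nonneg (by linarith) ENNReal.ofReal_ne_top)]
    _ ≤ ENNReal.ofReal B ^ (q - 2) * (C₀ : ℝ≥0∞) := by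
        gcongr
        refine le_of_eq_of_le (lintegral_congr fun x => ?_) (hC₀ t ht)
        rw [← ofReal_norm, ← ofReal_norm, norm_iteratedFDeriv_zero]

/-! ### The discharge -/

/-- **Grujić–Ruzmaikina 2004, Theorem 4.1 — proved.** The named fact
`grujicRuzmaikina2004_hybrid_direction_criterion` holds: for `ν > 0`, `T > 0`, `q ≥ 2` and a
classical unforced Navier–Stokes solution on `ℝ³ × [0, T)` in the Beale–Kato–Majda class on every
`[0, T'']`, `T'' < T`, hypotheses (i) `ω ∈ L^{q/(q−1)}(0,T; L^q)` and (ii)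
`‖ξ(x+y,t) × ξ(x,t)‖ ≤ c|y|^{1/q}` for `|ω(x,t)| ≥ M` give `‖ω(t)‖_{L^q}` bounded on a left
neighbourhood of `T`. Proof: the point `β = 1/q`, `r = q`, `1/θ = q/(q−1)` of the tree's
`holder_direction_vorticityLqLp_criterion_of_late` on `[T/2, T)` with threshold `max(M, 1)`
(continuation in the class past `T`), then `exists_eLpNorm_curl_le_of_hasBoundedSobolevNormsOn`
for the continuation on `[0, T]` (module docstring for the deviation from the printed
`L^{2p}`-level argument). [cite: GrujicRuzmaikina2004, Thm. 4.1 (p. 1076), Remark 4.3; Chae2007RMI, Thm. 1.2 (1.12) (p. 375)] -/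
theorem grujicRuzmaikina2004_hybrid_direction_criterion_holds :
    grujicRuzmaikina2004_hybrid_direction_criterion := by
  intro ν T q hν hT hq u p hsol hreg _hω₀ hLq hdir
  obtain ⟨c, M, hcM⟩ := hdir
  have hq0 : 0 < q := by linarith
  -- the parameters of the scaling line `2/r₂ + 3/r = 2 + β`: `β = 1/q`, `r = q`, `θ = 1 - 1/q`
  have hβ : 0 < 1 / q := by positivity
  have hr : 1 < q := by linarith
  have hβr : 1 / q * q < 3 := by
    rw [one_div_mul_cancel hq0.ne']
    norm_num
  have hup : 1 / q < (2 + 1 / q) / 3 := by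
    have h1 : 1 / q ≤ 1 / 2 := one_div_le_one_div_of_le two_pos hq
    linarith
  have hθ : 1 - 1 / q = 1 + 1 / q / 2 - 3 / 2 * (1 / q) := by ring
  have hθq : q / (q - 1) = 1 / (1 - 1 / q) := by
    have hq1 : q - 1 ≠ 0 := by linarith
    field_simp
  -- threshold and late initial time
  have hΩ : 0 < max M 1 := lt_max_of_lt_right one_pos
  have ht₀ : (0 : ℝ) ≤ T / 2 := by linarith
  have ht₀T : T / 2 < T := by linarith
  -- (ii) in the two-sided `√(1 - ⟪ξ(x), ξ(y)⟫²)` form on `[T/2, T)`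
  have hdir' : ∀ t ∈ Ico (T / 2) T, ∀ x y : EuclideanSpace ℝ (Fin 3),
      max M 1 < ‖curl (u t) x‖ → max M 1 < ‖curl (u t) y‖ →
      Real.sqrt (1 - ⟪vorticityDirection (curl (u t)) x, vorticityDirection (curl (u t)) y⟫ ^ 2) ≤
        c * ‖x - y‖ ^ (1 / q) := by
    intro t ht x y hx hy
    have htI : t ∈ Ioo 0 T := ⟨by linarith [ht.1], ht.2⟩
    have hMx : M ≤ ‖curl (u t) x‖ := (le_max_left M 1).trans hx.le
    have h := hcM t htI x hMx (y - x)
    have e : x + (y - x) = y := by abel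
    rw [e] at h
    have hx0 : curl (u t) x ≠ 0 := by
      intro h0
      rw [h0, norm_zero] at hx
      linarith
    have hy0 : curl (u t) y ≠ 0 := by
      intro h0
      rw [h0, norm_zero] at hy
      linarith
    have hx1 := norm_vorticityDirection (curl (u t)) hx0
    have hy1 := norm_vorticityDirection (curl (u t)) hy0
    calc Real.sqrt (1 - ⟪vorticityDirection (curl (u t)) x, vorticityDirection (curl (u t)) y⟫ ^ 2)
        = ‖cross (vorticityDirection (curl (u t)) y) (vorticityDirection (curl (u t)) x)‖ := by
          rw [← real_inner_comm, norm_cross_eq_sqrt_one_sub_inner_sq hy1 hx1]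
      _ ≤ c * ‖y - x‖ ^ (1 / q) := h
      _ = c * ‖x - y‖ ^ (1 / q) := by rw [norm_sub_rev]
  -- (i) on the late interval, exponent `1/θ = q/(q-1)`
  have hω' : MemLqLp (ENNReal.ofReal (1 / (1 - 1 / q))) (ENNReal.ofReal q)
      (fun t x => curl (u t) x) (Ioo (T / 2) T) := by
    rw [← hθq]
    exact hLq.mono_set (Ioo_subset_Ioo ht₀ le_rfl)
  -- continuation in the Beale–Kato–Majda class past `T`
  have hext : HasSobolevExtensionPast ν u T :=
    holder_direction_vorticityLqLp_criterion_of_late hν ht₀ ht₀T hΩ hβ hr hβr hup hθ hsol hreg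
      hdir' hω'
  obtain ⟨T', hT', u', p', hsol', hSob, hagree⟩ := hext
  have hsm : ∀ t ∈ Icc 0 T, ContDiff ℝ ∞ (u' t) := fun t ht =>
    hsol'.contDiff_velocity ⟨ht.1, lt_of_le_of_lt ht.2 hT'⟩
  obtain ⟨K, hKtop, hK⟩ := exists_eLpNorm_curl_le_of_hasBoundedSobolevNormsOn hSob hsm hq
  refine ⟨K.toReal, T / 2, ht₀T, fun t ht h0t => ?_⟩
  rw [ENNReal.ofReal_toReal hKtop.ne, ← hagree t ⟨h0t, ht.2⟩]
  exact hK t ⟨h0t, ht.2.le⟩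

end Literature.Analysis.FluidPDE

end
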